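import Summits.AtomisticToContinuum.Crystallization.Theorems.HullExactificationCascadeHcpLandscapeGapStubFibreDecomposition

/-!
# Crux `HcpLandscapeGap` (stmt-AtomisticToContinuum-12087), line `birth` — stub `stub_slipFibreDecomposition`

STUB SF of the skeleton `Cruxes/HcpLandscapeGap/Lines/birth.lean`: the LATERALLY SLIPPED analogue
of `stub_fibreDecomposition`.  Layer `k` is the triangular lattice of spacing `a ∈ [47/50, 1]`
translated in-plane by an ARBITRARY vector `τ k` (with `τ k 2 = 0`) and put at height `H k`
(spacings in `[39a/50, 17a/20]`).  A ball window `{x : dist x c ≤ L}` of this layered set is cut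
into vertical FIBRE INTERVALS — one site per layer over an integer interval of layers —, at most
`25 (L+1)²` of them, up to leftover points at depth `< 5` below the boundary sphere.

Construction.  For each layer `k` choose an integer vector `n_k ∈ ℤ²` with
`|n_k.1 u + n_k.2 v + τ k| ≤ √7/4 ≤ 6/5` (round the `v`-coordinate of `−τ k`, then the
`u`-coordinate: `SlipFibreDecomposition.exists_nearest`).  The fibre with index `f = (I, J)`
collects the sites `(I + n_k.1) u + (J + n_k.2) v + τ k + (H k) e₃`, `k ∈ ℤ`, each within `6/5`
of the fibre axis `I u + J v` (`SlipFibreDecomposition.dist_slipSite_axis_sq`); for fixed `k` the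
index map is a translation, hence injective.  The rest is the registered proof verbatim: with
`E_f` the squared in-plane distance from the axis to `c` and `T_f = √((L − 6/5)² − E_f)`, the
layer interval of `f` is `{k : |H k − c₂| ≤ T_f} = [M₁ f, M₂ f]`
(`FibreDecomposition.exists_firstLayer/lastLayer`), `F = {f : E_f ≤ (L − 6/5)²}` lies in a box of
side `≤ 5 (L + 1)` (`FibreDecomposition.fibre_box`), and an uncovered ball point is at depth
`< 12/5 < 5`.  For `L < 5` one takes `F = ∅`.  All [folklore] (elementary lattice geometry).
-/

noncomputable section

namespace Summit.AtomisticToContinuum.Crystallization.Theorems.HcpLandscapeGapBirth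

open Literature.MathematicalPhysics.StatisticalMechanics

namespace SlipFibreDecomposition

open FibreDecomposition

/-- Coordinates of the slipped site `i u + j v + τ + t e₃`. [folklore] -/
theorem slipSite_apply (a t : ℝ) (i j : ℤ) (τ : EuclideanSpace ℝ (Fin 3)) :
    ((i : ℝ) • triangularVec₁ a + (j : ℝ) • triangularVec₂ a + τ + layerNormal t) 0 =
        a * (i + j / 2) + τ 0 ∧
    ((i : ℝ) • triangularVec₁ a + (j : ℝ) • triangularVec₂ a + τ + layerNormal t) 1 =
        a * √3 / 2 * j + τ 1 ∧
    ((i : ℝ) • triangularVec₁ a + (j : ℝ) • triangularVec₂ a + τ + layerNormal t) 2 = τ 2 + t := by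
  refine ⟨?_, ?_, ?_⟩ <;> simp [triangularVec₁, triangularVec₂, layerNormal] <;> ring

/-- **Squared distance from a slipped fibre site to its axis point**: the site
`(I + n₁) u + (J + n₂) v + τ + t e₃` is at squared distance
`(a (n₁ + n₂/2) + τ₀)² + (a √3/2 · n₂ + τ₁)² + τ₂²` from the axis point `I u + J v + t e₃`.
[folklore] -/
theorem dist_slipSite_axis_sq (a t : ℝ) (I J n₁ n₂ : ℤ) (τ : EuclideanSpace ℝ (Fin 3)) :
    dist ((((I + n₁ : ℤ) : ℝ)) • triangularVec₁ a + (((J + n₂ : ℤ) : ℝ)) • triangularVec₂ a + τ +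
        layerNormal t)
      ((I : ℝ) • triangularVec₁ a + (J : ℝ) • triangularVec₂ a + layerNormal t) ^ 2 =
      (a * (n₁ + n₂ / 2) + τ 0) ^ 2 + (a * √3 / 2 * n₂ + τ 1) ^ 2 + (τ 2) ^ 2 := by
  obtain ⟨e0, e1, e2⟩ := slipSite_apply a t (I + n₁) (J + n₂) τ
  obtain ⟨f0, f1, f2⟩ := axis_apply a t I J
  rw [EuclideanSpace.dist_sq_eq, Fin.sum_univ_three, Real.dist_eq, Real.dist_eq, Real.dist_eq,
    sq_abs, sq_abs, sq_abs, e0, e1, e2, f0, f1, f2]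
  push_cast
  ring

/-- **An integer within `1/2`**: every real `t` has an integer `m` with `(t − m)² ≤ 1/4`
(`m = ⌊t + 1/2⌋`). [folklore] -/
theorem exists_int_near (t : ℝ) : ∃ m : ℤ, (t - m) ^ 2 ≤ 1 / 4 := by
  refine ⟨⌊t + 1 / 2⌋, ?_⟩
  have h1 := Int.floor_le (t + 1 / 2)
  have h2 := Int.lt_floor_add_one (t + 1 / 2)
  nlinarith

/-- **Nearest lattice point to a lateral slip.**  For `0 < a ≤ 1` and any in-plane vector
`(x, y)` there are integers `n₁, n₂` with `|n₁ u + n₂ v + (x, y)|² ≤ 7/16`: round the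
`v`-coordinate `2y/(a√3)` of `−(x, y)` to `n₂` (error `≤ a√3/4` in `y`), then the `u`-coordinate
to `n₁` (error `≤ a/2` in `x`). [folklore] -/
theorem exists_nearest {a : ℝ} (ha0 : 0 < a) (ha1 : a ≤ 1) (x y : ℝ) :
    ∃ n₁ n₂ : ℤ, (a * (n₁ + n₂ / 2) + x) ^ 2 + (a * √3 / 2 * n₂ + y) ^ 2 ≤ 7 / 16 := by
  have h3 : (0 : ℝ) < √3 := Real.sqrt_pos.2 (by norm_num)
  have h33 : (√3 : ℝ) ^ 2 = 3 := Real.sq_sqrt (by norm_num)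
  set β : ℝ := 2 * y / (a * √3) with hβ
  set α : ℝ := x / a with hα
  have hx : x = a * α := by rw [hα]; field_simp
  have hy : y = a * √3 / 2 * β := by rw [hβ]; field_simp
  obtain ⟨n₂, hn₂⟩ := exists_int_near (-β)
  obtain ⟨n₁, hn₁⟩ := exists_int_near (-(α + n₂ / 2))
  refine ⟨n₁, n₂, ?_⟩
  have hEq : (a * (n₁ + n₂ / 2) + x) ^ 2 + (a * √3 / 2 * n₂ + y) ^ 2 =
      a ^ 2 * ((-(α + n₂ / 2) - n₁) ^ 2 + 3 / 4 * (-β - n₂) ^ 2) := by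
    rw [hx, hy]
    linear_combination (a ^ 2 * (-β - (n₂ : ℝ)) ^ 2 / 4) * h33
  rw [hEq]
  have ha2 : a ^ 2 ≤ 1 := by nlinarith
  calc a ^ 2 * ((-(α + n₂ / 2) - n₁) ^ 2 + 3 / 4 * (-β - n₂) ^ 2)
      ≤ 1 * (1 / 4 + 3 / 4 * (1 / 4)) :=
        mul_le_mul ha2 (by linarith) (by positivity) (by norm_num)
    _ = 7 / 16 := by norm_num

end SlipFibreDecomposition

open FibreDecomposition SlipFibreDecomposition in
/-- **Stub SF — fibre decomposition of a ball window of a laterally slipped layered set.**  There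
is an absolute `C` (`= 25`) such that for `a ∈ [47/50, 1]`, heights `H` with spacings in
`[39a/50, 17a/20]`, in-plane slips `τ k` (`τ k 2 = 0`), every centre `c` and radius `L ≥ 0` there
are: a finite set `F` of fibre indices with `#F ≤ C (L+1)²`, layer intervals `[M₁ f, M₂ f]`
(possibly empty) and in-layer indices `ι f k` (injective in `f` for each layer `k`) such that every
fibre site `(ι f k).1 u + (ι f k).2 v + τ k + (H k) e₃` with `k ∈ [M₁ f, M₂ f]`, `f ∈ F`, lies in
the closed ball `dist · c ≤ L`, and every point `i u + j v + τ k + (H k) e₃` of that ball not so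
covered lies at depth `< 5`: `L − 5 < dist · c`.  Construction: `ι (I, J) k = (I + n_k.1, J + n_k.2)`
with `n_k` a lattice vector within `√7/4 ≤ 6/5` of `−τ k` (`exists_nearest`);
`[M₁ f, M₂ f] = {k : |H k − c₂| ≤ T_f}`, `T_f = √((L − 6/5)² − E_f)`, `E_f` the squared in-plane
distance of the axis `I u + J v` to `c`; `F = {f : E_f ≤ (L − 6/5)²}` inside a box of side
`≤ 5 (L+1)`; `F = ∅` if `L < 5`. [folklore] -/
theorem stub_slipFibreDecomposition : ∃ C : ℝ, ∀ (a : ℝ), 47 / 50 ≤ a → a ≤ 1 → ∀ H : ℤ → ℝ, (∀ k : ℤ, 39 / 50 * a ≤ H (k + 1) - H k ∧ H (k + 1) - H k ≤ 17 / 20 * a) → ∀ τ : ℤ → EuclideanSpace ℝ (Fin 3), (∀ k : ℤ, τ k 2 = 0) → ∀ (c : EuclideanSpace ℝ (Fin 3)) (L : ℝ), 0 ≤ L → ∃ (F : Finset (ℤ × ℤ)) (M₁ M₂ : ℤ × ℤ → ℤ) (ι : ℤ × ℤ → ℤ → ℤ × ℤ), (F.card : ℝ) ≤ C * (L + 1)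 ^ 2 ∧ (∀ k : ℤ, Function.Injective (fun f : ℤ × ℤ => ι f k)) ∧ (∀ f ∈ F, ∀ k : ℤ, M₁ f ≤ k → k ≤ M₂ f → dist (((ι f k).1 : ℝ) • Literature.MathematicalPhysics.StatisticalMechanics.triangularVec₁ a + ((ι f k).2 : ℝ) • Literature.MathematicalPhysics.StatisticalMechanics.triangularVec₂ a + τ k + Literature.MathematicalPhysics.StatisticalMechanics.layerNormal (H k)) c ≤ L) ∧ (∀ k i j : ℤ, dist ((i : ℝ) • Literature.MathematicalPhysics.StatisticalMechanics.triangularVec₁ a + (j : ℝ) • Literature.MathematicalPhysics.StatisticalMechanics.triangularVec₂ a + τ k + Literature.MathematicalPhysics.StatisticalMechanics.layerNormal (H k)) c ≤ L → (∃ f ∈ F, M₁ f ≤ k ∧ k ≤ M₂ f ∧ ι f k = (i, j)) ∨ L - 5 < dist ((i : ℝ) • Literature.MathematicalPhysics.StatisticalMechanics.triangularVec₁ a + (j : ℝ) • Literature.MathematicalPhysics.StatisticalMechanics.triangularVec₂ a + τ k + Literature.MathematicalPhysics.StatisticalMechanics.layerNormal (H k)) c) := by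
  refine ⟨25, fun a ha1 ha2 H hH τ hτ c L hL => ?_⟩
  rcases lt_or_ge L 5 with hL5 | hL5
  · -- small balls: everything is within depth `5`
    refine ⟨∅, fun _ => 0, fun _ => 0, fun f _ => f, ?_, fun k => Function.injective_id, ?_, ?_⟩
    · simp only [Finset.card_empty, Nat.cast_zero]; positivity
    · simp
    · intro k i j _
      exact Or.inr (by linarith [dist_nonneg (x := (i : ℝ) • triangularVec₁ a +
        (j : ℝ) • triangularVec₂ a + τ k + layerNormal (H k)) (y := c)])
  -- main case `5 ≤ L`
  have ha0 : 0 < a := by linarith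
  have hgap : ∀ k : ℤ, 39 / 50 * a ≤ H (k + 1) - H k := fun k => (hH k).1
  obtain ⟨P, hP⟩ := exists_firstLayer (H := H) (by positivity : (0 : ℝ) < 39 / 50 * a) hgap
  obtain ⟨Q, hQ⟩ := exists_lastLayer (H := H) (by positivity : (0 : ℝ) < 39 / 50 * a) hgap
  -- per-layer lattice vectors `n k` nearest to `-τ k`
  obtain ⟨n, hn⟩ : ∃ n : ℤ → ℤ × ℤ, ∀ k : ℤ,
      (a * ((n k).1 + (n k).2 / 2) + τ k 0) ^ 2 + (a * √3 / 2 * (n k).2 + τ k 1) ^ 2 ≤ 7 / 16 := by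
    choose n₁ n₂ h using fun k : ℤ => exists_nearest ha0 ha2 (τ k 0) (τ k 1)
    exact ⟨fun k => (n₁ k, n₂ k), h⟩
  -- the box of fibre indices
  set N : ℤ := ⌈5 / 4 * L⌉ + 1 with hN
  have hN1 : 5 / 4 * L + 1 ≤ (N : ℝ) := by
    rw [hN]; push_cast; linarith [Int.le_ceil (5 / 4 * L)]
  have hN2 : (N : ℝ) < 5 / 4 * L + 2 := by
    rw [hN]; push_cast; linarith [Int.ceil_lt_add_one (5 / 4 * L)]
  have hN0 : 0 ≤ N := by
    have : (0 : ℝ) ≤ N := by linarith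
    exact_mod_cast this
  obtain ⟨I₀, J₀, hbox⟩ := fibre_box ha1 (c 0) (c 1) hL hN1
  -- squared in-plane offset of the axis and the half-height of the layer interval
  obtain ⟨E, hE⟩ : ∃ E : ℤ × ℤ → ℝ, ∀ f, E f =
      (a * (f.1 + f.2 / 2) - c 0) ^ 2 + (a * √3 / 2 * f.2 - c 1) ^ 2 := ⟨_, fun _ => rfl⟩
  obtain ⟨T, hT⟩ : ∃ T : ℤ × ℤ → ℝ, ∀ f, T f = √((L - 6 / 5) ^ 2 - E f) := ⟨_, fun _ => rfl⟩
  have hT0 : ∀ f, 0 ≤ T f := fun f => by rw [hT]; exact Real.sqrt_nonneg _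
  -- geometry of the fibre sites: axis point `Y f k = f.1 u + f.2 v + (H k) e₃`
  have hXY : ∀ (f : ℤ × ℤ) (k : ℤ), dist ((((f.1 + (n k).1 : ℤ) : ℝ)) • triangularVec₁ a +
      (((f.2 + (n k).2 : ℤ) : ℝ)) • triangularVec₂ a + τ k + layerNormal (H k))
      ((f.1 : ℝ) • triangularVec₁ a + (f.2 : ℝ) • triangularVec₂ a + layerNormal (H k)) ≤ 6 / 5 := by
    intro f k
    refine (pow_le_pow_iff_left₀ dist_nonneg (by norm_num) two_ne_zero).1 ?_
    rw [dist_slipSite_axis_sq, hτ k]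
    nlinarith [hn k]
  have hYc : ∀ (f : ℤ × ℤ) (k : ℤ),
      dist ((f.1 : ℝ) • triangularVec₁ a + (f.2 : ℝ) • triangularVec₂ a + layerNormal (H k)) c ^ 2 =
        E f + (H k - c 2) ^ 2 := fun f k => by
    rw [dist_axis_sq, hE]
  refine ⟨(Finset.Icc (I₀ - N) (I₀ + N) ×ˢ Finset.Icc (J₀ - N) (J₀ + N)).filter
      (fun f => E f ≤ (L - 6 / 5) ^ 2),
    fun f => P (c 2 - T f), fun f => Q (c 2 + T f), fun f k => (f.1 + (n k).1, f.2 + (n k).2),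
    ?_, ?_, ?_, ?_⟩
  · -- `#F ≤ (2N+1)² ≤ 25 (L+1)²`
    have hIcc : ∀ m : ℤ, ((Finset.Icc (m - N) (m + N)).card : ℝ) = 2 * N + 1 := by
      intro m
      rw [Int.card_Icc, show m + N + 1 - (m - N) = 2 * N + 1 by ring, ← Int.cast_natCast,
        Int.toNat_of_nonneg (by omega)]
      push_cast; ring
    calc (((Finset.Icc (I₀ - N) (I₀ + N) ×ˢ Finset.Icc (J₀ - N) (J₀ + N)).filter
          (fun f => E f ≤ (L - 6 / 5) ^ 2)).card : ℝ)
        ≤ ((Finset.Icc (I₀ - N) (I₀ + N) ×ˢ Finset.Icc (J₀ - N) (J₀ + N)).card : ℝ) := by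
          exact_mod_cast Finset.card_filter_le _ _
      _ = (2 * N + 1) * (2 * N + 1) := by rw [Finset.card_product, Nat.cast_mul, hIcc, hIcc]
      _ ≤ 25 * (L + 1) ^ 2 := by
          have h0 : (0 : ℝ) ≤ N := by exact_mod_cast hN0
          have h1 : (2 * N + 1 : ℝ) ≤ 5 * (L + 1) := by linarith
          nlinarith
  · -- injectivity in `f` for fixed `k`
    intro k f g hfg
    simp only [Prod.mk.injEq, add_left_inj] at hfg
    exact Prod.ext hfg.1 hfg.2
  · -- fibre sites of `F` over `[M₁ f, M₂ f]` lie in the ball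
    intro f hf k hk1 hk2
    rw [Finset.mem_filter] at hf
    have hEf : E f ≤ (L - 6 / 5) ^ 2 := hf.2
    have h1 : c 2 - T f ≤ H k := (hP _ k).1 hk1
    have h2 : H k ≤ c 2 + T f := (hQ _ k).1 hk2
    have hT2 : T f ^ 2 = (L - 6 / 5) ^ 2 - E f := by
      rw [hT]; exact Real.sq_sqrt (by linarith)
    have h3 : (H k - c 2) ^ 2 ≤ T f ^ 2 := sq_le_sq' (by linarith) (by linarith)
    have h4 : dist ((f.1 : ℝ) • triangularVec₁ a + (f.2 : ℝ) • triangularVec₂ a +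
        layerNormal (H k)) c ≤ L - 6 / 5 := by
      refine (pow_le_pow_iff_left₀ dist_nonneg (by linarith) two_ne_zero).1 ?_
      rw [hYc]; linarith
    show dist ((((f.1 + (n k).1 : ℤ) : ℝ)) • triangularVec₁ a +
      (((f.2 + (n k).2 : ℤ) : ℝ)) • triangularVec₂ a + τ k + layerNormal (H k)) c ≤ L
    linarith [dist_triangle ((((f.1 + (n k).1 : ℤ) : ℝ)) • triangularVec₁ a +
      (((f.2 + (n k).2 : ℤ) : ℝ)) • triangularVec₂ a + τ k + layerNormal (H k))
      ((f.1 : ℝ) • triangularVec₁ a + (f.2 : ℝ) • triangularVec₂ a + layerNormal (H k)) c, hXY f k]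
  · -- a ball point is covered or within depth `12/5 < 5`
    intro k i j hdist
    have hXY' := hXY (i - (n k).1, j - (n k).2) k
    have hYc' := hYc (i - (n k).1, j - (n k).2) k
    simp only [sub_add_cancel] at hXY'
    by_cases hY : dist ((((i - (n k).1 : ℤ) : ℝ)) • triangularVec₁ a + (((j - (n k).2 : ℤ) : ℝ)) •
        triangularVec₂ a + layerNormal (H k)) c ≤ L - 6 / 5
    · -- covered by the fibre `f = (i - n_k.1, j - n_k.2)`
      left
      have hsq : E (i - (n k).1, j - (n k).2) + (H k - c 2) ^ 2 ≤ (L - 6 / 5) ^ 2 := by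
        rw [← hYc']; exact pow_le_pow_left₀ dist_nonneg hY 2
      have hEf : E (i - (n k).1, j - (n k).2) ≤ (L - 6 / 5) ^ 2 := by
        nlinarith [sq_nonneg (H k - c 2)]
      have habs : |H k - c 2| ≤ T (i - (n k).1, j - (n k).2) := by
        rw [hT]; exact Real.abs_le_sqrt (by linarith)
      obtain ⟨hlo, hhi⟩ := abs_le.1 habs
      have hEL : E (i - (n k).1, j - (n k).2) ≤ L ^ 2 := by nlinarith
      have hb := hbox (i - (n k).1) (j - (n k).2) (by rw [hE] at hEL; exact_mod_cast hEL)
      refine ⟨(i - (n k).1, j - (n k).2), ?_, (hP _ k).2 (by linarith), (hQ _ k).2 (by linarith),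
        ?_⟩
      · rw [Finset.mem_filter, Finset.mem_product, Finset.mem_Icc, Finset.mem_Icc]
        exact ⟨⟨⟨hb.1, hb.2.1⟩, hb.2.2.1, hb.2.2.2⟩, hEf⟩
      · simp
    · -- not covered: the axis point is far, hence so is the site
      right
      push Not at hY
      linarith [dist_triangle ((((i - (n k).1 : ℤ) : ℝ)) • triangularVec₁ a +
        (((j - (n k).2 : ℤ) : ℝ)) • triangularVec₂ a + layerNormal (H k))
        ((i : ℝ) • triangularVec₁ a + (j : ℝ) • triangularVec₂ a + τ k + layerNormal (H k)) c,
        dist_comm ((((i - (n k).1 : ℤ) : ℝ)) • triangularVec₁ a +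
        (((j - (n k).2 : ℤ) : ℝ)) • triangularVec₂ a + layerNormal (H k))
        ((i : ℝ) • triangularVec₁ a + (j : ℝ) • triangularVec₂ a + τ k + layerNormal (H k))]

end Summit.AtomisticToContinuum.Crystallization.Theorems.HcpLandscapeGapBirth

end
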